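import Mathlib.RingTheory.Polynomial.Resultant.Basic
import Mathlib.FieldTheory.RatFunc.AsPolynomial
import Mathlib.RingTheory.Polynomial.GaussLemma
import Mathlib.RingTheory.Polynomial.Eisenstein.Criterion

/-!
# Finiteness of `V(f, G)` on an affine plane curve (support lemma for [GenEll] Thm 2.1, item GenEllTwo)

For a field `K`, a bivariate polynomial is written `f ∈ K[x][Y]` (`Polynomial (Polynomial K)`, the
outer variable `Y` over the coefficient ring `K[x]`), and its value at `(a, b) ∈ Ω²` for a field
`Ω ⊇ K` is `(f.map (aeval a)).eval b`.  We prove the classical facts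

* `aeval_resultant_eq_zero_of_common_zero`: a common zero `(a, b)` of `f, G` forces
  `Res_Y(f, G)(a) = 0` (Bézout identity `f·p + G·q = Res` from Mathlib's Sylvester-matrix theory);
* `resultant_ne_zero_of_isCoprime_map`: if `f` is monic in `Y` and `f, G` are coprime in `K(x)[Y]`
  then `Res_Y(f, G) ≠ 0` in `K[x]`;
* `finite_commonZeros`: hence `V(f, G)(Ω) ⊆ Ω²` is FINITE (`x`-coordinates among the roots of the
  resultant, `Y`-coordinates among the roots of the monic `f(a, Y)`);
* `isCoprime_map_of_irreducible` (Gauss): `f` monic irreducible in `K[x][Y]` and `f ∤ G` give the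
  coprimality hypothesis; `irreducible_X_pow_sub_C_of_prime` (Eisenstein): `Y^e − c(x)` is
  irreducible as soon as some prime `π` of `K[x]` divides `c` exactly once — e.g. the curves
  `r^e = x(1−x)` (`π = x`) and `w^e = 1 − u^e` (`π = 1 − u`, characteristic `0`) of the two
  GenEllTwo architectures (abc-iut cell, S6 GENELLTWO-P1ROUTE / S4 GENELLTWO-PLAN).

Use (support item GenEllTwo = stmt-ABC-19679): the fibre `t⁻¹(b)` of a rational function on the
curve, resp. the trace `V(G) ∩ {f = 0}` of a form, is a finite set of algebraic points; this is the
finite set `Δ` consumed by the good-prime localisation lemma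
`Literature.NumberTheory.DiophantineGeometry.PlaneCurve.exists_den_localisation`
(PlaneCurveLocalisation.lean) — the consumer enlarges the number field to contain the coordinates.
Classical algebra (Bombieri–Gubler B.1.7–B.1.13 on resultants; Lang, *Algebra*, IV §§2–3); nothing here refers to, or takes a
side on, any disputed claim.
-/

namespace Literature.NumberTheory.DiophantineGeometry.PlaneCurve

open Polynomial

universe u v

variable {K : Type u} [Field K] {Ω : Type v} [Field Ω] [Algebra K Ω]

/-- **A common zero kills the resultant.**  If `(a, b) ∈ Ω²` is a common zero of
`f, G ∈ K[x][Y]` and `f` has positive `Y`-degree, then the resultant `Res_Y(f, G) ∈ K[x]` vanishes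
at `x = a`.  (From the Bézout identity `f·p + G·q = Res_Y(f,G)` — Mathlib
`Polynomial.exists_mul_add_mul_eq_C_resultant` — transported along `x ↦ a`.)
[cite: BombieriGubler2006, B.1.8 with B.1.12 (resultant and common roots; compatibility with ring homomorphisms)] -/
theorem aeval_resultant_eq_zero_of_common_zero (f G : K[X][X]) (hdeg : f.natDegree ≠ 0)
    (a b : Ω) (hf : (f.map (aeval a).toRingHom).eval b = 0)
    (hG : (G.map (aeval a).toRingHom).eval b = 0) :
    aeval a (resultant f G) = 0 := by
  obtain ⟨p, q, -, -, hpq⟩ := exists_mul_add_mul_eq_C_resultant (f.map (aeval a).toRingHom)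
    (G.map (aeval a).toRingHom) (m := f.natDegree) (n := G.natDegree) natDegree_map_le
    natDegree_map_le (Or.inl hdeg)
  rw [resultant_map_map] at hpq
  have h := congrArg (eval b) hpq
  rw [eval_add, eval_mul, eval_mul, hf, hG, zero_mul, zero_mul, zero_add, eval_C] at h
  exact h.symm

/-- **Coprime in `K(x)[Y]` ⇒ nonzero resultant.**  If `f ∈ K[x][Y]` is monic in `Y` and the images
of `f, G` in `K(x)[Y]` are coprime, then `Res_Y(f, G) ≠ 0` in `K[x]` (Mathlib
`Polynomial.resultant_eq_zero_iff` over the field `K(x) = RatFunc K`, and `resultant_map_map`).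
[cite: BombieriGubler2006, B.1.8 (res(f,g) ≠ 0 iff f, g coprime, f monic) with B.1.12] -/
theorem resultant_ne_zero_of_isCoprime_map (f G : K[X][X]) (hf : f.Monic)
    (hcop : IsCoprime (f.map (algebraMap K[X] (RatFunc K))) (G.map (algebraMap K[X] (RatFunc K)))) :
    resultant f G ≠ 0 := by
  intro h0
  set φ := algebraMap K[X] (RatFunc K) with hφ
  have hinj : Function.Injective φ := IsFractionRing.injective K[X] (RatFunc K)
  have hres : resultant (f.map φ) (G.map φ) = 0 := by
    have h1 : (f.map φ).natDegree = f.natDegree := hf.natDegree_map φ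
    have h2 : (G.map φ).natDegree = G.natDegree := natDegree_map_eq_of_injective hinj G
    rw [resultant, h1, h2, ← resultant, resultant_map_map, h0, map_zero]
  exact (resultant_eq_zero_iff.mp hres).2 hcop

/-- **Finiteness of `V(f, G)`.**  Let `f ∈ K[x][Y]` be monic of positive degree in `Y` and coprime
to `G` in `K(x)[Y]`.  Then for every field `Ω ⊇ K` the set of common zeros
`{(a, b) ∈ Ω² : f(a, b) = 0 = G(a, b)}` is finite: `a` is a root of the nonzero resultant and `b` a
root of the monic polynomial `f(a, Y)`.  (Two plane curves without a common component meet in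
finitely many points.) [cite: BombieriGubler2006, B.1.8 with B.1.12 (elimination by the resultant)] -/
theorem finite_commonZeros (f G : K[X][X]) (hf : f.Monic) (hdeg : f.natDegree ≠ 0)
    (hcop : IsCoprime (f.map (algebraMap K[X] (RatFunc K))) (G.map (algebraMap K[X] (RatFunc K)))) :
    Set.Finite {z : Ω × Ω | (f.map (aeval z.1).toRingHom).eval z.2 = 0 ∧
      (G.map (aeval z.1).toRingHom).eval z.2 = 0} := by
  classical
  have hR : resultant f G ≠ 0 := resultant_ne_zero_of_isCoprime_map f G hf hcop
  have hRΩ : (resultant f G).map (algebraMap K Ω) ≠ 0 :=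
    Polynomial.map_ne_zero hR
  -- the finite candidate set: roots of the resultant × roots of `f(a, Y)`
  let T : Set (Ω × Ω) := ⋃ a ∈ (((resultant f G).map (algebraMap K Ω)).roots.toFinset : Set Ω),
    (fun b => (a, b)) '' {b | b ∈ (f.map (aeval a).toRingHom).roots}
  have hT : T.Finite := by
    refine Set.Finite.biUnion (Finset.finite_toSet _) fun a _ => Set.Finite.image _ ?_
    exact (f.map (aeval a).toRingHom).roots.finite_toSet
  refine hT.subset fun z hz => ?_
  obtain ⟨hfz, hGz⟩ := hz
  have ha : z.1 ∈ (((resultant f G).map (algebraMap K Ω)).roots.toFinset : Set Ω) := by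
    rw [Finset.mem_coe, Multiset.mem_toFinset, mem_roots hRΩ, IsRoot.def, eval_map,
      ← aeval_def]
    exact aeval_resultant_eq_zero_of_common_zero f G hdeg z.1 z.2 hfz hGz
  have hb : z.2 ∈ (f.map (aeval z.1).toRingHom).roots := by
    rw [mem_roots (hf.map _).ne_zero, IsRoot.def]
    exact hfz
  simp only [T, Set.mem_iUnion, Set.mem_image, Set.mem_setOf_eq]
  exact ⟨z.1, ha, z.2, hb, rfl⟩

/-- **Gauss's lemma supplies the coprimality hypothesis.**  If `f ∈ K[x][Y]` is monic and
irreducible and does not divide `G` in `K[x][Y]`, then the images of `f` and `G` in `K(x)[Y]` are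
coprime (`K(x)[Y]` is a PID; a monic polynomial divides in `K[x][Y]` iff it divides in `K(x)[Y]`).
[cite: Lang2002, Ch. IV §2 Thm 2.3 (Gauss lemma) with Ch. IV §1 (K(x)[Y] principal)] -/
theorem isCoprime_map_of_irreducible (f G : K[X][X]) (hf : f.Monic) (hirr : Irreducible f)
    (hnd : ¬ f ∣ G) :
    IsCoprime (f.map (algebraMap K[X] (RatFunc K))) (G.map (algebraMap K[X] (RatFunc K))) := by
  have hirr' : Irreducible (f.map (algebraMap K[X] (RatFunc K))) :=
    (hf.irreducible_iff_irreducible_map_fraction_map (K := RatFunc K)).mp hirr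
  refine (hirr'.coprime_iff_not_dvd).mpr fun hdvd => hnd ?_
  exact (map_dvd_map _ (IsFractionRing.injective K[X] (RatFunc K)) hf).mp hdvd

/-- **Eisenstein for `Y^e − c(x)`.**  If `π ∈ K[x]` is prime, `π ∣ c` and `π² ∤ c`, then
`Y^e − C c ∈ K[x][Y]` is irreducible for every `e ≥ 1` (monic Eisenstein polynomial at `(π)`).
Instances: `c = x(1−x)`, `π = x` (the superelliptic curve `r^e = x(1−x)` of the GenEllTwo ℙ¹-route);
`c = 1 − u^e`, `π = 1 − u` in characteristic `0` (the Fermat curve `u^e + w^e = 1`).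
[cite: Lang2002, Ch. IV §3 Thm 3.1 (Eisenstein's criterion)] -/
theorem irreducible_X_pow_sub_C_of_prime (e : ℕ) (he : 0 < e) (c π : K[X]) (hπ : Prime π)
    (h1 : π ∣ c) (h2 : ¬ π ^ 2 ∣ c) : Irreducible (X ^ e - C c : K[X][X]) := by
  have he0 : e ≠ 0 := Nat.pos_iff_ne_zero.mp he
  have hmonic : (X ^ e - C c : K[X][X]).Monic := monic_X_pow_sub_C c he0
  have hP : (Ideal.span {π} : Ideal K[X]).IsPrime :=
    (Ideal.span_singleton_prime hπ.ne_zero).mpr hπ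
  have hcoeff : ∀ n, (X ^ e - C c : K[X][X]).coeff n =
      (if n = e then 1 else 0) - (if n = 0 then c else 0) := fun n => by
    rw [coeff_sub, coeff_X_pow, coeff_C]
  refine irreducible_of_eisenstein_criterion hP ?_ ?_ ?_ ?_ hmonic.isPrimitive
  · rw [hmonic.leadingCoeff]
    exact (Ideal.ne_top_iff_one _).mp hP.ne_top
  · intro n hn
    have hn' : n < e := by
      have := coe_lt_degree.1 hn
      rwa [natDegree_X_pow_sub_C] at this
    rw [hcoeff, if_neg (Nat.ne_of_lt hn')]
    by_cases h0 : n = 0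
    · rw [if_pos h0, zero_sub]
      exact neg_mem_iff.mpr (Ideal.mem_span_singleton.mpr h1)
    · rw [if_neg h0, sub_zero]
      exact Ideal.zero_mem _
  · rw [degree_X_pow_sub_C he]
    exact_mod_cast he
  · rw [hcoeff, if_neg (Ne.symm he0), if_pos rfl, zero_sub, neg_mem_iff, Ideal.span_singleton_pow,
      Ideal.mem_span_singleton]
    exact h2

/-- The superelliptic instance: `Y^e − x(1−x)` is irreducible in `K[x][Y]` for every field `K` and
every `e ≥ 1` (Eisenstein at the prime `x`: `x ∣ x(1−x)`, `x² ∤ x(1−x)`).  This is the affine equation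
`r^e = x(1−x)` of the auxiliary curve `D_e` of the GenEllTwo ℙ¹-route.
[cite: Lang2002, Ch. IV §3 Thm 3.1 (Eisenstein's criterion), instance Y^e − x(1−x)] -/
theorem irreducible_X_pow_sub_C_X_mul_one_sub_X (e : ℕ) (he : 0 < e) :
    Irreducible (X ^ e - C (X * (1 - X)) : K[X][X]) := by
  refine irreducible_X_pow_sub_C_of_prime e he _ X prime_X (dvd_mul_right X _) fun h => ?_
  -- `X² ∣ X (1 − X)` would give `X ∣ 1 − X`, i.e. `X ∣ 1`
  rw [pow_two] at h
  have h' : X ∣ (1 - X : K[X]) := (mul_dvd_mul_iff_left X_ne_zero).mp h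
  have h1 : X ∣ (1 : K[X]) := by simpa using dvd_add h' (dvd_refl X)
  exact prime_X.not_unit (isUnit_of_dvd_one h1)

/-- The Fermat instance: `Y^e − (1 − x^e)` is irreducible in `K[x][Y]` whenever `e ≥ 1` and
`e ≠ 0` in `K` (Eisenstein at the prime `x − 1`: `x − 1 ∣ 1 − x^e`, and `(x−1)² ∣ 1 − x^e` would make
`1` a root of `1 + x + ⋯ + x^{e−1}`, i.e. `e = 0` in `K`).  This is the affine equation
`u^e + w^e = 1` of the Fermat curve of the GenEllTwo plane-curve route.
[cite: Lang2002, Ch. IV §3 Thm 3.1 (Eisenstein's criterion), instance Y^e − (1 − x^e)] -/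
theorem irreducible_X_pow_sub_C_one_sub_X_pow (e : ℕ) (he : 0 < e) (heK : (e : K) ≠ 0) :
    Irreducible (X ^ e - C (1 - X ^ e) : K[X][X]) := by
  have hfac : (1 - X ^ e : K[X]) = (X - C 1) * (-(∑ i ∈ Finset.range e, X ^ i)) := by
    rw [map_one, mul_neg, mul_comm, geom_sum_mul, neg_sub]
  refine irreducible_X_pow_sub_C_of_prime e he _ (X - C 1) (prime_X_sub_C 1) ⟨_, hfac⟩ fun h => ?_
  rw [hfac, pow_two, mul_neg, dvd_neg, mul_dvd_mul_iff_left (X_sub_C_ne_zero 1), dvd_iff_isRoot,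
    IsRoot.def, eval_geom_sum] at h
  simp only [one_pow, Finset.sum_const, Finset.card_range, nsmul_eq_mul, mul_one] at h
  exact heK h

end Literature.NumberTheory.DiophantineGeometry.PlaneCurve
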